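import Summits.CriticalPhenomena.PercolationContinuityZ3.Theorems.FK.ConditionalEnergyPatterns
import Literature.Probability.LatticeModels.RandomClusterEdgeWeightsHomogeneous
import HarnessLib

/-!
# FK-continuity transplant, FO-10 seat B (iv): the conditional two-sided finite-energy bounds and quasi-independence
# for the HOMOGENEOUS measure `φ^B_{G,p,q} = rcMeasure G p q B` (Grimmett 2006, Thm. (3.1) eq. (3.4), Thm. (4.17)(b))

Cell `fk-continuity` (bschramm), registry row FO-10b; support file of the FK-continuity transplant
(`--supports stmt-CriticalPhenomena-4575`, helper); builds on p205010 (kernel theorem, internal audit signed;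
external expert review pending). No definitions, no named facts, no sorries; standard axioms.

The three preceding files of the row (`ConditionalEnergyToolkit`, `…Determined`, `…Patterns`) are written for the
edge-parameter measure `rcMeasureW w q B` on all pairs of a finite vertex type. The cell's infinite-volume stack
(`InfiniteVolumeDefs.lean`: `rcBoxMeasure/rcBoxLaw`) and row FO-06b's integrated tolerances
(`RandomClusterFiniteEnergy.lean`, p242692) are typed over the homogeneous measure `rcMeasure G p q B` of a finite graph.
By the tree's bridge `rcMeasure_eq_rcMeasureW` (`RandomClusterEdgeWeightsHomogeneous.lean`: `φ^B_{G,p,q}` is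
`φ^B_{𝐩,q}` with `𝐩 = p·1_{E(G)}`) every statement transfers; we record the transferred forms (`p : unitInterval`;
for a real `p ∈ [0,1]` instantiate `p := ⟨p, hp⟩`, the coercion is definitionally `p`). For `A` determined by a set
`K` of pairs, a finite set `F ⊆ E(G)` of edges with `F ∩ K = ∅`, `π = p/(p + q(1-p))`, `q ≥ 1`:

* `rcMeasure_pow_mul_real_le_real_inter_subset`, `rcMeasure_real_inter_subset_le_pow_mul`:
  `π^{|F|} φ(A) ≤ φ(A ∩ {F open}) ≤ p^{|F|} φ(A)`;
* `rcMeasure_pow_mul_real_le_real_inter_forall_notMem`, `rcMeasure_real_inter_forall_notMem_le_pow_mul`: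
  `(1-p)^{|F|} φ(A) ≤ φ(A ∩ {F closed}) ≤ (1-π)^{|F|} φ(A)`;
* `rcMeasure_real_inter_le_pow_mul_real_mul_real`, `rcMeasure_real_mul_real_le_pow_mul_real_inter`:
  quasi-independence `q^{-|S|} φ(A) φ(D) ≤ φ(A ∩ D) ≤ q^{|S|} φ(A) φ(D)` for `D` determined by a finite set `S` of
  pairs disjoint from `K` (no condition `S ⊆ E(G)`).
These are the F2/F34-family replacements of the cell's cone census (CONE-PERDECL §C #17, #19, #23, #24, #30, #31:
`bondPercolation_inter_of_disjoint`, `prodBernoulli_real_inter_of_determinedBy`, `prodBernoulli_real_forall_notMem`,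
`prodBernoulli_real_subset`, `bondPercolation_real_setOf_subset`, `le_bondPercolation_real_forall_notMem`) for the
finite-volume random-cluster measures with an arbitrary wired set `B` — hence for every boundary condition.

## References

* G. Grimmett, *The Random-Cluster Model*, Springer 2006: §1.4 eq. (1.20) (p. 15); Thm. (3.1)(a), eqs. (3.3)–(3.4)
  (pp. 37–38); Thm. (4.17)(b) (p. 75). [Grimmett2006]
-/

noncomputable section

open MeasureTheory Finset
open scoped ENNReal Classical

namespace Summit.CriticalPhenomena.PercolationContinuityZ3.Theorems.FK

open Literature.Probability.Percolation Literature.Probability.LatticeModels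

variable {V : Type*} [Fintype V] [DecidableEq V] (G : SimpleGraph V) [DecidableRel G.Adj]

omit [Fintype V] [DecidableEq V] [DecidableRel G.Adj] in
/-- On an edge of `G` the indicator parameter is `p`. [cite: Grimmett2006, §1.4 eq. (1.20) (p. 15)] -/
theorem coe_edgeIndicatorWeights_of_mem_edgeSet (p : unitInterval) {e : Sym2 V} (he : e ∈ G.edgeSet) :
    ((edgeIndicatorWeights G p e : unitInterval) : ℝ) = p := by
  unfold edgeIndicatorWeights
  rw [if_pos he]

omit [Fintype V] [DecidableEq V] [DecidableRel G.Adj] in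
/-- On the edges of a finite set `F ⊆ E(G)` the indicator parameters equal `p`. [cite: Grimmett2006, §1.4 eq. (1.20) (p. 15)] -/
theorem coe_edgeIndicatorWeights_of_subset_edgeFinset [Fintype G.edgeSet] (p : unitInterval) {F : Finset (Sym2 V)}
    (hF : F ⊆ G.edgeFinset) : ∀ e ∈ F, ((edgeIndicatorWeights G p e : unitInterval) : ℝ) = p := fun _ he =>
  coe_edgeIndicatorWeights_of_mem_edgeSet G p (SimpleGraph.mem_edgeFinset.1 (hF he))

variable {A : Set (BondConfig V)} {K : Set (Sym2 V)}

/-- **`π^{|F|} φ^B_{G,p,q}(A) ≤ φ^B_{G,p,q}(A ∩ {F open})`** for `A` determined by `K`, `F ⊆ E(G)` disjoint from `K`,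
`π = p/(p + q(1-p))`, `q ≥ 1` — Grimmett's `φ(e open | 𝒯_e) ≥ p/(p + q(1-p))`, iterated, conditional on `A`.
[cite: Grimmett2006, Thm. (3.1)(a) eq. (3.4) (p. 38); Thm. (4.17)(b) (p. 75)] -/
theorem rcMeasure_pow_mul_real_le_real_inter_subset (p : unitInterval) {q : ℝ} (hq : 1 ≤ q) (B : Set V)
    (hA : DeterminedBy A K) {F : Finset (Sym2 V)} (hF : F ⊆ G.edgeFinset) (hKF : ∀ e ∈ F, e ∉ K) :
    ((p : ℝ) / (p + q * (1 - p))) ^ F.card * (rcMeasure G p q B).real A ≤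
      (rcMeasure G p q B).real (A ∩ {ω | (↑F : Set (Sym2 V)) ⊆ ω}) := by
  rw [rcMeasure_eq_rcMeasureW G p (one_pos.trans_le hq) B]
  exact rcMeasureW_pow_mul_real_le_real_inter_subset_of_eq _ hq B hA hKF
    (coe_edgeIndicatorWeights_of_subset_edgeFinset G p hF)

/-- **`φ^B_{G,p,q}(A ∩ {F open}) ≤ p^{|F|} φ^B_{G,p,q}(A)`** for `A` determined by `K`, `F ⊆ E(G)` disjoint from `K`,
`q ≥ 1` — Grimmett's `φ(e open | 𝒯_e) ≤ p`, iterated, conditional on `A`.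
[cite: Grimmett2006, Thm. (3.1)(a) eq. (3.4) (p. 38); Thm. (4.17)(b) (p. 75)] -/
theorem rcMeasure_real_inter_subset_le_pow_mul (p : unitInterval) {q : ℝ} (hq : 1 ≤ q) (B : Set V)
    (hA : DeterminedBy A K) {F : Finset (Sym2 V)} (hF : F ⊆ G.edgeFinset) (hKF : ∀ e ∈ F, e ∉ K) :
    (rcMeasure G p q B).real (A ∩ {ω | (↑F : Set (Sym2 V)) ⊆ ω}) ≤ (p : ℝ) ^ F.card * (rcMeasure G p q B).real A := by
  rw [rcMeasure_eq_rcMeasureW G p (one_pos.trans_le hq) B]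
  exact rcMeasureW_real_inter_subset_le_pow_mul_of_eq _ hq B hA hKF
    (coe_edgeIndicatorWeights_of_subset_edgeFinset G p hF)

/-- **`(1-p)^{|F|} φ^B_{G,p,q}(A) ≤ φ^B_{G,p,q}(A ∩ {F closed})`** for `A` determined by `K`, `F ⊆ E(G)` disjoint from
`K`, `q ≥ 1` — Grimmett's `φ(e closed | 𝒯_e) ≥ 1 - p`, iterated, conditional on `A`.
[cite: Grimmett2006, Thm. (3.1)(a) eq. (3.4) (p. 38); Thm. (4.17)(b) (p. 75)] -/
theorem rcMeasure_pow_mul_real_le_real_inter_forall_notMem (p : unitInterval) {q : ℝ} (hq : 1 ≤ q) (B : Set V)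
    (hA : DeterminedBy A K) {F : Finset (Sym2 V)} (hF : F ⊆ G.edgeFinset) (hKF : ∀ e ∈ F, e ∉ K) :
    (1 - (p : ℝ)) ^ F.card * (rcMeasure G p q B).real A ≤ (rcMeasure G p q B).real (A ∩ {ω | ∀ e ∈ F, e ∉ ω}) := by
  rw [rcMeasure_eq_rcMeasureW G p (one_pos.trans_le hq) B]
  exact rcMeasureW_pow_mul_real_le_real_inter_forall_notMem_of_eq _ hq B hA hKF
    (coe_edgeIndicatorWeights_of_subset_edgeFinset G p hF)

/-- **`φ^B_{G,p,q}(A ∩ {F closed}) ≤ (1-π)^{|F|} φ^B_{G,p,q}(A)`** for `A` determined by `K`, `F ⊆ E(G)` disjoint from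
`K`, `1 - π = q(1-p)/(p + q(1-p))`, `q ≥ 1`. [cite: Grimmett2006, Thm. (3.1)(a) eq. (3.4) (p. 38); Thm. (4.17)(b) (p. 75)] -/
theorem rcMeasure_real_inter_forall_notMem_le_pow_mul (p : unitInterval) {q : ℝ} (hq : 1 ≤ q) (B : Set V)
    (hA : DeterminedBy A K) {F : Finset (Sym2 V)} (hF : F ⊆ G.edgeFinset) (hKF : ∀ e ∈ F, e ∉ K) :
    (rcMeasure G p q B).real (A ∩ {ω | ∀ e ∈ F, e ∉ ω}) ≤
      (q * (1 - (p : ℝ)) / (p + q * (1 - p))) ^ F.card * (rcMeasure G p q B).real A := by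
  rw [rcMeasure_eq_rcMeasureW G p (one_pos.trans_le hq) B]
  exact rcMeasureW_real_inter_forall_notMem_le_pow_mul_of_eq _ hq B hA hKF
    (coe_edgeIndicatorWeights_of_subset_edgeFinset G p hF)

/-- **Quasi-independence for `φ^B_{G,p,q}`, upper half**: for `A` determined by `K` and `D` determined by a finite set
`S` of pairs disjoint from `K`, `q ≥ 1`: `φ(A ∩ D) ≤ q^{|S|} · φ(A) φ(D)` — the FK replacement of the product law of
the `q = 1` chain (`bondPercolation_inter_of_disjoint`). [cite: Grimmett2006, Thm. (3.1)(a) eq. (3.4) (p. 38); Thm. (4.17)(b) (p. 75)] -/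
theorem rcMeasure_real_inter_le_pow_mul_real_mul_real (p : unitInterval) {q : ℝ} (hq : 1 ≤ q) (B : Set V)
    (hA : DeterminedBy A K) {S : Finset (Sym2 V)} (hKS : ∀ e ∈ S, e ∉ K) {D : Set (BondConfig V)}
    (hD : DeterminedBy D (↑S : Set (Sym2 V))) :
    (rcMeasure G p q B).real (A ∩ D) ≤ q ^ S.card * ((rcMeasure G p q B).real A * (rcMeasure G p q B).real D) := by
  rw [rcMeasure_eq_rcMeasureW G p (one_pos.trans_le hq) B]
  exact rcMeasureW_real_inter_le_pow_mul_real_mul_real _ hq B hA hKS hD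

/-- **Quasi-independence for `φ^B_{G,p,q}`, lower half**: `φ(A) φ(D) ≤ q^{|S|} · φ(A ∩ D)` for `A` determined by `K`,
`D` determined by a finite set `S` of pairs disjoint from `K`, `q ≥ 1`. [cite: Grimmett2006, Thm. (3.1)(a) eq. (3.4) (p. 38); Thm. (4.17)(b) (p. 75)] -/
theorem rcMeasure_real_mul_real_le_pow_mul_real_inter (p : unitInterval) {q : ℝ} (hq : 1 ≤ q) (B : Set V)
    (hA : DeterminedBy A K) {S : Finset (Sym2 V)} (hKS : ∀ e ∈ S, e ∉ K) {D : Set (BondConfig V)}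
    (hD : DeterminedBy D (↑S : Set (Sym2 V))) :
    (rcMeasure G p q B).real A * (rcMeasure G p q B).real D ≤ q ^ S.card * (rcMeasure G p q B).real (A ∩ D) := by
  rw [rcMeasure_eq_rcMeasureW G p (one_pos.trans_le hq) B]
  exact rcMeasureW_real_mul_real_le_pow_mul_real_inter _ hq B hA hKS hD

end Summit.CriticalPhenomena.PercolationContinuityZ3.Theorems.FK

end
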